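import Summits.QuantumFields.BalabanUV.Beta.D1BFx.GhostLeg
import Literature.MathematicalPhysics.QuantumFieldTheory.Balaban1983to89.B3GkZeroLatticePointwise
import Literature.MathematicalPhysics.QuantumFieldTheory.Balaban1983to89.B6QGQFourier275Zd
import Literature.MathematicalPhysics.QuantumFieldTheory.Balaban1983to89.B3ZdLatticeProfileSums

/-!
# `BalabanUV.Beta.D1BFx.GhostLegLattice` — road «BF-x» for binder row D1, slot (K), (II)-rows (C1)(C2) «TB4-W CO-FRAME FIRST JET ∕ TABLE,
# m-UNIFORM MASS», FILE β1 «GGH-BRIDGE»: **THE ROAD's SCALAR GHOST LEG `Ggh (L^k) a` IS lit-balaban's INFINITE-LATTICE ZERO-FIELD PROPAGATOR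
# `G_k(0)` (`B3GkZeroLattice.GkLat (L−1) k a′ 0`) AT EVERY SCALE `n = L^k`, `k ≥ 1`** — so that the Literature tree's kernel-checked short-distance
# profile of `G_k(0)` ([Balaban1983Higgs3] p. 437, `B3GkZeroLatticePointwise`) becomes available for the road's `Ggh`, `Pgt`, `Rgt`, `Cgh` (FILE β2).

HONEST DEPENDENCY (cell records, verbatim): «continuum YM on T⁴ ⇐ BetaPertH ∧ nine spine estimates (0/9 proved); BetaPertH ⇐ (D1) ∧ (D4) ∧
CAP+tail; G-an2-4 gates asym, D1 and NE2/3/4.»  HONEST FRAMING (cell contract, verbatim): «discharging `BetaPertH` makes Bałaban's UV stability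
UNCONDITIONAL — a real constructive-QFT result; it is NOT the continuum limit and NOT the Clay problem.»  THIS MODULE DISCHARGES NOTHING of the
wall: [folklore] bookkeeping BY NAME over two LANDED lineages that typed the same operator twice — the road's `B6QGQLower276.AX` ∕ `B5Hk103ScalarZd.Gk` ∕
`GhostLeg.Ggh` (block side `n`, fixed `a`) and lit-balaban's `B4Reflection242.lapK ∕ avgK` ∕ `B3GkZeroLattice.latOpK ∕ GkLat` (`n = L^k`, running `a_k`):
(i) the two site matrices agree entrywise, (ii) `B3GkZeroLattice.green_GkLat` makes `G_k(0)` a right inverse of the road's matrix, (iii) it is bounded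
(`B3GkZeroLatticePointwise.abs_GkLat_profile`), (iv) bounded solutions are unique (`B6QGQFourier275Zd.eq_tsum_Gk_mul_rowAX`).  No definition, no
`def … : Prop`, nothing cited as a hypothesis, 0 sorry.  0 root-level binders of row D1 discharged (hW ∕ hR-sockets ∕ hSX-socket ∕ D1Tel ∕ D1Rep = 0);
(K) NOT closed; (C1)(C2) NOT closed by this file; NOT D1, NOT `BetaPertH`, NOT continuum, NOT Clay.

ABSOLUTE RULE (cell charter, verbatim): «No internally-minted statement may enter as a cited fact. Every hypothesis is either kernel-proved in
this package or a verbatim quotation of a PUBLISHED theorem with page reference. The manuscript(s) under audit are NOT citable for their own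
disputed steps — they are the thing under adjudication; programme-internal (2001/route/tribunal) claims are never citable.»

WHY (OWNER d1-p2 g19 RULING ρ-g19-1∕ρ-g19-2, journal l.43347; this seat's located count W-1 l.43312).  The road's open (II)-rows (C1)(C2) need
n-FREE ℓ¹ ROW∕COLUMN MASSES of the legs `Ggh`, `lapU∘Ggh`, `Pgt`, `Rgt`, `Cgh = n⁴·Ggh∘Rgt∘Ggh`; the road's own letters for `Ggh` are SUP letters
(`GhostLeg.abs_Ggh_le`: `2∕min 2 a`, i.e. row mass `≍ n⁴` through `Zl`), while the truth (and the Literature tree) is `|G_k(0)(x,y)| ≤ C·n⁻²·(max 1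
|x−y|_∞)⁻²·e^{−δ|x−y|_∞∕n}` (row mass `O(1)`).  This file is the junction; the END evaluates only on the scales `n = Lc^m` (ρ-g19-2), so the
restriction `n = L^k` loses nothing.

CONTENT (`L ≥ 2`, `k ≥ 1`, `n = L^k`, `a > 0`; sites `Fin 4 → ℤ`).
* §1 [folklore] `lapKer_eq_lapK` (the two Laplacian kernels), `blk_eq_blk` (the two block labellings), **`latOpK_eq_AX`**:
  `B3GkZeroLattice.latOpK n a 0 x z = B6QGQLower276.AX (n−1) a x z` — `n²(−Δ) + (a∕n⁴)·1[same block]` on both sides.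
* §2 [folklore] `exists_aSeq_eq` (a family parameter `a′ ∈ [a, a∕(1−L⁻²)]` — a k-FREE window — with `B1.aSeq a′ L k = a`), `exists_GkLat_bound`
  (`G_k(0)` is bounded on that window, from the profile), `rowAX_GkLat` (`Σ'_r AX (n−1) a z r·G_k(0)(r,y) = δ_{zy}`), and THE BRIDGE
  **`Ggh_eq_GkLat`**: `Ggh n a x y u v = GkLat (L−1) k a′ 0 x y`.
* §3 [folklore toolkit for β2] `card_shell_le4` (`#{|u|_∞ = r} ≤ 80r³` on `ℤ⁴`), `sum_radial_le4`, `sum_profile4_le`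
  (`Σ_{u∈F} (max 1 |u|_∞)^{−p}e^{−c|u|_∞} ≤ 1 + 2560∕c^{4−p}`, `p ∈ {2,3}`; the `ℤ³` twins are lit-balaban's `B3ZdLatticeProfileSums`).
NOT HERE: the profile ∕ gradient profile ∕ masses of `Ggh` in the road's currency (FILE β2 `GhostLegProfile`), the leg masses (γ), the co-frame words (δ).
Unit `b2b-balaban-gan24-formalise-leaf-05` (gen 54), G-an2-4 swarm leaf prover 05, road «BF-x» supplier ∕ (C1)(C2) count owner; INTENT «GGH-BRIDGE» (journal).
-/

noncomputable section

namespace Summit.QuantumFields.BalabanUV.Beta.D1BFx.GhostLegLattice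

open scoped BigOperators
open Literature.MathematicalPhysics.QuantumFieldTheory.Balaban1983to89
open Literature.MathematicalPhysics.QuantumFieldTheory.Balaban1983to89.Beta
open ExpKernelCalculus (Site MKer)
open Summit.QuantumFields.BalabanUV.Beta.D1BFx.GhostLeg (Ggh Ggh_apply)

/-! ## §1 The two site matrices agree: `latOpK n a 0 = AX (n−1) a` on `ℤ⁴` -/

section Operator

open B6QGQLower276 (X e side blk lapDir lapKer sameBlk AX)

/-- [folklore] `z ∈ nbrs x ↔ ∃ μ, z = x + e μ ∨ z = x − e μ` (`B4Reflection242.mem_nbrs` in `B6QGQLower276.e`). -/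
theorem mem_nbrs_iff_e (x z : Fin 4 → ℤ) : z ∈ B4Reflection242.nbrs x ↔ ∃ μ : Fin 4, z = x + e μ ∨ z = x - e μ :=
  B4Reflection242.mem_nbrs

/-- [folklore] `x + e μ ≠ x − e ν` on `ℤ⁴`. -/
theorem add_e_ne_sub_e (x : Fin 4 → ℤ) (μ ν : Fin 4) : x + e μ ≠ x - e ν := by
  intro h
  have h1 := congrFun h μ
  by_cases hμν : μ = ν
  · subst hμν
    simp [e] at h1
    omega
  · simp [e, hμν] at h1

/-- [folklore] `x + e μ = x + e ν ↔ μ = ν`. -/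
theorem add_e_eq_add_e_iff (x : Fin 4 → ℤ) (μ ν : Fin 4) : x + e μ = x + e ν ↔ μ = ν := by
  refine ⟨fun h => ?_, by rintro rfl; rfl⟩
  by_contra hμν
  have h1 := congrFun h ν
  simp [e, Ne.symm hμν] at h1

/-- [folklore] `x − e μ = x − e ν ↔ μ = ν`. -/
theorem sub_e_eq_sub_e_iff (x : Fin 4 → ℤ) (μ ν : Fin 4) : x - e μ = x - e ν ↔ μ = ν := by
  refine ⟨fun h => ?_, by rintro rfl; rfl⟩
  by_contra hμν
  have h1 := congrFun h ν
  simp [e, Ne.symm hμν] at h1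
  omega

/-- [folklore] `x + e μ ≠ x`, `x − e μ ≠ x`. -/
theorem add_e_ne_self (x : Fin 4 → ℤ) (μ : Fin 4) : x + e μ ≠ x ∧ x - e μ ≠ x :=
  ⟨fun h => by have h1 := congrFun h μ; simp [e] at h1, fun h => by have h1 := congrFun h μ; simp [e] at h1⟩

/-- [folklore] **THE TWO LAPLACIAN KERNELS AGREE**: `B6QGQLower276.lapKer x z` (`Σ_μ (2δ − δ_{z,x+e_μ} − δ_{z,x−e_μ})`) is
`B4Reflection242.lapK x z` (`8` on the diagonal, `−1` on nearest neighbours, `0` else) on `ℤ⁴`. -/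
theorem lapKer_eq_lapK (x z : Fin 4 → ℤ) : lapKer (d := 4) x z = B4Reflection242.lapK (R := ℝ) (d := 3) x z := by
  unfold lapKer lapDir B4Reflection242.lapK
  by_cases hzx : z = x
  · subst hzx
    have h1 : ∀ μ : Fin 4, ((if z = z then (2 : ℝ) else 0) - (if z = z + e μ then 1 else 0) - (if z = z - e μ then 1 else 0)) = 2 := by
      intro μ
      rw [if_pos rfl, if_neg (fun h => (add_e_ne_self z μ).1 h.symm), if_neg (fun h => (add_e_ne_self z μ).2 h.symm)]
      ring
    rw [Finset.sum_congr rfl (fun μ _ => h1 μ), if_pos rfl]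
    simp
    norm_num
  · rw [if_neg hzx]
    simp only [if_neg hzx, zero_sub]
    by_cases hn : z ∈ B4Reflection242.nbrs x
    · rw [if_pos hn]
      obtain ⟨i, hi | hi⟩ := (mem_nbrs_iff_e x z).1 hn
      · subst hi
        have h1 : ∀ μ : Fin 4, (-(if x + e i = x + e μ then (1 : ℝ) else 0) - (if x + e i = x - e μ then 1 else 0))
            = if μ = i then -1 else 0 := by
          intro μ
          rw [if_neg (add_e_ne_sub_e x i μ)]
          by_cases hμ : μ = i
          · subst hμ; simp
          · rw [if_neg (fun h => hμ ((add_e_eq_add_e_iff x i μ).1 h).symm), if_neg hμ]; ring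
        rw [Finset.sum_congr rfl (fun μ _ => h1 μ)]
        simp
      · subst hi
        have h1 : ∀ μ : Fin 4, (-(if x - e i = x + e μ then (1 : ℝ) else 0) - (if x - e i = x - e μ then 1 else 0))
            = if μ = i then -1 else 0 := by
          intro μ
          rw [if_neg (fun h => add_e_ne_sub_e x μ i h.symm)]
          by_cases hμ : μ = i
          · subst hμ; simp
          · rw [if_neg (fun h => hμ ((sub_e_eq_sub_e_iff x i μ).1 h).symm), if_neg hμ]; ring
        rw [Finset.sum_congr rfl (fun μ _ => h1 μ)]
        simp
    · rw [if_neg hn]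
      have h1 : ∀ μ : Fin 4, (-(if z = x + e μ then (1 : ℝ) else 0) - (if z = x - e μ then 1 else 0)) = 0 := by
        intro μ
        rw [if_neg (fun h => hn ((mem_nbrs_iff_e x z).2 ⟨μ, Or.inl h⟩)), if_neg (fun h => hn ((mem_nbrs_iff_e x z).2 ⟨μ, Or.inr h⟩))]
        ring
      rw [Finset.sum_congr rfl (fun μ _ => h1 μ)]
      simp

variable (n : ℕ) [NeZero n]

/-- [folklore] The two block labellings agree: `B4Reflection242.blk n x = B6QGQLower276.blk (n−1) x` (floor division by the block side `n`). -/
theorem blk_eq_blk (x : Fin 4 → ℤ) : B4Reflection242.blk (d := 3) n x = blk (d := 4) (n - 1) x := by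
  funext i
  rw [GhostLeg.blk_pred_apply]
  rfl

/-- [folklore] **THE TWO SITE MATRICES AGREE**: lit-balaban's `latOpK n a 0` (`n²(−Δ) + 0 + (a∕n⁴)·1[same block]`, B3GkZeroLattice) IS the
road's `AX (n−1) a` (`B6QGQLower276`, block side `n`), entrywise on `ℤ⁴`. -/
theorem latOpK_eq_AX (a : ℝ) (x z : Fin 4 → ℤ) : B3GkZeroLattice.latOpK (d := 3) n a 0 x z = AX (d := 4) (n - 1) a x z := by
  rw [B3GkZeroLattice.latOpK, GhostLeg.AX_pred_apply, lapKer_eq_lapK]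
  simp only [B4Reflection242.diagK, B4Reflection242.avgK, sameBlk, blk_eq_blk n, ite_self, zero_add]
  by_cases h : blk (d := 4) (n - 1) z = blk (n - 1) x
  · rw [if_pos h, if_pos h.symm]
    have : (3 + 1 : ℕ) = 4 := rfl
    simp [div_eq_mul_inv]
  · rw [if_neg h, if_neg (fun h' => h h'.symm)]
    simp

end Operator

/-! ## §2 The bridge: `Ggh (L^k) a = G_k(0)` (lit-balaban's `GkLat`) -/

section Bridge

open B6QGQLower276 (X AX)
open B5Hk103ScalarZd (Gk)
open B6QGQFourier275Zd (rowAX eq_tsum_Gk_mul_rowAX)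
open B3GkZeroLattice (GkLat latOpK latOpK_eq_zero green_GkLat)
open B4ContourShift (supNorm supNorm_nonneg)

variable {L : ℕ} (hL : 2 ≤ L)
include hL

/-- [folklore] `0 < L⁻² < 1` for `L ≥ 2`. -/
theorem invSq_pos_lt_one : 0 < ((L : ℝ) ^ 2)⁻¹ ∧ ((L : ℝ) ^ 2)⁻¹ < 1 := by
  have hL' : (2 : ℝ) ≤ L := by exact_mod_cast hL
  have h4 : (4 : ℝ) ≤ (L : ℝ) ^ 2 := by nlinarith
  refine ⟨by positivity, ?_⟩
  rw [inv_lt_one_iff₀]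
  right; linarith

/-- [folklore] **THE FAMILY PARAMETER**: for `L ≥ 2`, `k ≥ 1` and the road's FIXED `a ≥ 0` there is a lit-balaban family parameter `a′` IN THE
k-FREE WINDOW `[a, a∕(1 − L⁻²)]` whose running coefficient `a_k = a′(1 − L⁻²)∕(1 − L^{−2k})` (`B1.aSeq a′ L k`) IS `a`
(witness `a′ = a·(1 − L^{−2k})∕(1 − L⁻²)`). -/
theorem exists_aSeq_eq {a : ℝ} (ha : 0 ≤ a) {k : ℕ} (hk : 1 ≤ k) :
    ∃ a' : ℝ, B1.aSeq a' (L : ℝ) k = a ∧ a ≤ a' ∧ a' ≤ a / (1 - ((L : ℝ) ^ 2)⁻¹) := by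
  obtain ⟨hq0, hq1⟩ := invSq_pos_lt_one hL
  set q : ℝ := ((L : ℝ) ^ 2)⁻¹ with hq
  have hqk1 : q ^ k < 1 := pow_lt_one₀ hq0.le hq1 (by omega)
  have hqk : q ^ k ≤ q := by
    calc q ^ k = q * q ^ (k - 1) := by rw [← pow_succ', Nat.sub_add_cancel hk]
      _ ≤ q * 1 := mul_le_mul_of_nonneg_left (pow_le_one₀ hq0.le hq1.le) hq0.le
      _ = q := mul_one q
  have h1 : 0 < 1 - q := by linarith
  have h2 : 0 < 1 - q ^ k := by linarith
  refine ⟨a * (1 - q ^ k) / (1 - q), ?_, ?_, ?_⟩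
  · rw [B1.aSeq_eq, ← hq, div_mul_cancel₀ _ h1.ne', mul_div_assoc, div_self h2.ne', mul_one]
  · rw [le_div_iff₀ h1]
    nlinarith
  · exact div_le_div_of_nonneg_right (by nlinarith [pow_nonneg hq0.le k]) h1.le

/-- [folklore] `((L − 1 : ℕ) : ℝ) + 1 = L` and `(L − 1) + 1 = L` for `L ≥ 2`. -/
theorem cast_L_pred : (((L - 1 : ℕ) : ℝ)) + 1 = (L : ℝ) ∧ (L - 1) + 1 = L :=
  ⟨by rw [Nat.cast_sub (by omega)]; push_cast; ring, by omega⟩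

/-- [folklore] **`G_k(0)` IS BOUNDED** (from lit-balaban's profile `abs_GkLat_profile`): for `L ≥ 2`, `a > 0` there is `M` with
`|GkLat (L−1) k a′ 0 x y| ≤ M` for every `k ≥ 1`, every `a′ ∈ [a, a∕(1−L⁻²)]`, all `x y`. -/
theorem exists_GkLat_bound {a : ℝ} (ha : 0 < a) :
    ∃ M : ℝ, ∀ (k : ℕ), 1 ≤ k → ∀ a' : ℝ, a ≤ a' → a' ≤ a / (1 - ((L : ℝ) ^ 2)⁻¹) →
      ∀ x y : Fin 4 → ℤ, |GkLat (d := 3) (L - 1) k a' 0 x y| ≤ M := by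
  obtain ⟨δ, C, hδ, hC, h⟩ := B3GkZeroLatticePointwise.abs_GkLat_profile 3 (L - 1) (by norm_num) (by omega)
    a (a / (1 - ((L : ℝ) ^ 2)⁻¹)) 0 ha
  refine ⟨C, fun k hk a' h1 h2 x y => ?_⟩
  have hb := h k hk a' 0 h1 h2 le_rfl le_rfl x y
  have hLr : (((L - 1 : ℕ) : ℝ)) + 1 = (L : ℝ) := (cast_L_pred hL).1
  rw [hLr] at hb
  have hL1 : (1 : ℝ) ≤ (L : ℝ) := by exact_mod_cast (show 1 ≤ L by omega)
  have hn1 : (1 : ℝ) ≤ (L : ℝ) ^ k := one_le_pow₀ hL1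
  have hn0 : (0 : ℝ) < (L : ℝ) ^ k := by positivity
  set s : ℝ := max 1 (supNorm (x - y)) with hs
  have hs1 : 1 ≤ s := le_max_left _ _
  have hfac : (s / (L : ℝ) ^ k)⁻¹ ^ (3 - 1) ≤ ((L : ℝ) ^ k) ^ 2 := by
    rw [show (3 - 1 : ℕ) = 2 from rfl, inv_div]
    have : (L : ℝ) ^ k / s ≤ (L : ℝ) ^ k := div_le_self hn0.le hs1
    exact pow_le_pow_left₀ (by positivity) this 2
  have hexp : Real.exp (-(δ * (supNorm (x - y) / (L : ℝ) ^ k))) ≤ 1 := by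
    rw [Real.exp_le_one_iff]
    have := supNorm_nonneg (x - y)
    have : 0 ≤ δ * (supNorm (x - y) / (L : ℝ) ^ k) := by positivity
    linarith
  have hub : ((L : ℝ) ^ k) ^ (3 + 1) * |GkLat (d := 3) (L - 1) k a' 0 x y| ≤ C * ((L : ℝ) ^ k) ^ 2 * 1 := by
    refine hb.trans ?_
    exact mul_le_mul (mul_le_mul_of_nonneg_left hfac hC.le) hexp (Real.exp_pos _).le (by positivity)
  have hn4pos : (0 : ℝ) < ((L : ℝ) ^ k) ^ (3 + 1) := by positivity
  have hG : |GkLat (d := 3) (L - 1) k a' 0 x y| * ((L : ℝ) ^ k) ^ (3 + 1) ≤ C * ((L : ℝ) ^ k) ^ (3 + 1) := by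
    calc |GkLat (d := 3) (L - 1) k a' 0 x y| * ((L : ℝ) ^ k) ^ (3 + 1)
        = ((L : ℝ) ^ k) ^ (3 + 1) * |GkLat (d := 3) (L - 1) k a' 0 x y| := mul_comm _ _
      _ ≤ C * ((L : ℝ) ^ k) ^ 2 * 1 := hub
      _ ≤ C * ((L : ℝ) ^ k) ^ (3 + 1) := by
          rw [mul_one]; exact mul_le_mul_of_nonneg_left (pow_le_pow_right₀ hn1 (by norm_num)) hC.le
  exact le_of_mul_le_mul_right hG hn4pos

omit hL in
/-- [folklore] The row action of the road's site matrix on a column of `G_k(0)` is the Kronecker delta: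
`Σ'_r AX (n−1) a z r · GkLat (L−1) k a′ 0 r y = δ_{z,y}` whenever `a_k(a′) = a` (`n = L^k`; lit-balaban's `green_GkLat` read through
`latOpK_eq_AX`). -/
theorem rowAX_GkLat {L : ℕ} (hL : 2 ≤ L) {k : ℕ} (hk : 1 ≤ k) {a a' : ℝ} (ha' : 0 < a') (haS : B1.aSeq a' (L : ℝ) k = a)
    (n : ℕ) [NeZero n] (hn : n = L ^ k) (z y : Fin 4 → ℤ) :
    rowAX (d := 4) (n - 1) a (fun r => GkLat (d := 3) (L - 1) k a' 0 r y) z = if z = y then 1 else 0 := by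
  have hn1 : 1 ≤ n := NeZero.one_le
  obtain ⟨hLr, hLn⟩ := cast_L_pred hL
  have hℓ : 1 ≤ L - 1 := by omega
  have hg := green_GkLat (d := 3) hℓ hk ha' le_rfl z y
  rw [hLr, haS, hLn, ← hn] at hg
  rw [rowAX, ← hg,
    tsum_eq_sum (s := B4Reflection242.opSupp n z)
      (fun r hr => by rw [← latOpK_eq_AX n a z r, latOpK_eq_zero hn1 a 0 hr, zero_mul])]
  exact Finset.sum_congr rfl (fun r _ => by rw [latOpK_eq_AX n a z r])

omit hL in
/-- [folklore] **THE BRIDGE `Ggh (L^k) a = G_k(0)`**: the road's scalar ghost leg (`GhostLeg.Ggh n a = Gk (n−1) a`, the B4-Sect.-5 exhaustion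
inverse of `Δ^η + aQ′*Q′` on `ℤ⁴`, block side `n`) IS lit-balaban's infinite-lattice zero-field propagator `B3GkZeroLattice.GkLat (L−1) k a′ 0`
at every scale `n = L^k`, `k ≥ 1`, `L ≥ 2`, for any family parameter `a′` in the window with `a_k(a′) = a` (`exists_aSeq_eq`): both are bounded
kernels solving `(Δ^η + aQ′*Q′)G = 1` entrywise on `ℤ⁴`, and bounded solutions are unique (`B6QGQFourier275Zd.eq_tsum_Gk_mul_rowAX`). -/
theorem Ggh_eq_GkLat {L : ℕ} (hL : 2 ≤ L) {k : ℕ} (hk : 1 ≤ k) {a a' : ℝ} (ha : 0 < a) (haS : B1.aSeq a' (L : ℝ) k = a)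
    (hw : a ≤ a' ∧ a' ≤ a / (1 - ((L : ℝ) ^ 2)⁻¹)) (n : ℕ) [NeZero n] (hn : n = L ^ k) (x y : Site 4) (u v : Unit) :
    Ggh n a x y u v = GkLat (d := 3) (L - 1) k a' 0 x y := by
  obtain ⟨M, hM⟩ := exists_GkLat_bound hL ha
  have hφ : ∀ r : Fin 4 → ℤ, |GkLat (d := 3) (L - 1) k a' 0 r y| ≤ M := fun r => hM k hk _ hw.1 hw.2 r y
  have key := eq_tsum_Gk_mul_rowAX (d := 4) (n - 1) ha (φ := fun r => GkLat (d := 3) (L - 1) k a' 0 r y) hφ x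
  rw [Ggh_apply, key]
  simp_rw [rowAX_GkLat hL hk (lt_of_lt_of_le ha hw.1) haS n hn]
  rw [tsum_eq_single y (fun z hz => by rw [if_neg hz, mul_zero])]
  rw [if_pos rfl, mul_one]

end Bridge


/-! ## §3 [toolkit] Shell counting on `ℤ⁴` and the two lattice profile sums (for FILE β2's masses) -/

section ShellsOpen
open Finset
open B3Sect3VectorSelfEnergy (ZSite)
open B3CxiUniformBound (supNorm)
open B3ZdLatticeProfileSums (mem_box_iff card_box supNorm_eq_zero_iff sum_Ico_pow_mul_exp_le)

/-- [folklore] **SHELL COUNTING ON `ℤ⁴`**: `#{u ∈ ℤ⁴ : |u|_∞ = r} ≤ 80·r³` (`(2r+1)⁴ − (2r−1)⁴ = 64r³ + 16r`; the `ℤ³` twin is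
`B3ZdLatticeProfileSums.card_shell_le`). -/
theorem card_shell_le4 (M r : ℕ) (hr : 1 ≤ r) :
    (((Fintype.piFinset (fun _ : Fin 4 => Finset.Icc (-(M : ℤ)) M)).filter (fun u => supNorm u = r)).card : ℝ) ≤
      80 * (r : ℝ) ^ 3 := by
  set B : ℕ → Finset (ZSite 4) := fun K => Fintype.piFinset (fun _ : Fin 4 => Finset.Icc (-(K : ℤ)) K) with hB
  have hsub : (B M).filter (fun u => supNorm u = r) ⊆ B r \ B (r - 1) := by
    intro u hu
    rw [Finset.mem_filter] at hu
    rw [Finset.mem_sdiff, hB, mem_box_iff, mem_box_iff]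
    omega
  have hinc : B (r - 1) ⊆ B r := by
    intro u hu
    rw [hB, mem_box_iff] at hu ⊢
    omega
  have hcard : ((B r \ B (r - 1)).card : ℝ) = (2 * r + 1 : ℝ) ^ 4 - (2 * r - 1 : ℝ) ^ 4 := by
    rw [Finset.card_sdiff_of_subset hinc, hB, card_box, card_box]
    have hle : (2 * (r - 1) + 1) ^ 4 ≤ (2 * r + 1) ^ 4 := Nat.pow_le_pow_left (by omega) 4
    rw [Nat.cast_sub hle]
    obtain ⟨m, rfl⟩ : ∃ m, r = m + 1 := ⟨r - 1, by omega⟩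
    simp only [Nat.add_sub_cancel]
    push_cast
    ring
  calc (((B M).filter (fun u => supNorm u = r)).card : ℝ) ≤ ((B r \ B (r - 1)).card : ℝ) := by
        exact_mod_cast Finset.card_le_card hsub
    _ = (2 * r + 1 : ℝ) ^ 4 - (2 * r - 1 : ℝ) ^ 4 := hcard
    _ = 64 * (r : ℝ) ^ 3 + 16 * r := by ring
    _ ≤ 80 * (r : ℝ) ^ 3 := by
        have h1 : (1 : ℝ) ≤ r := by exact_mod_cast hr
        have h3 : (r : ℝ) ≤ (r : ℝ) ^ 3 := le_self_pow₀ h1 (by norm_num)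
        linarith

/-- [folklore] **RADIAL MAJORIZATION ON `ℤ⁴`**: `Σ_{u∈F} h(|u|_∞) ≤ h(0) + Σ_{1≤r≤M} 80r³·h(r)` for `h ≥ 0` (`M = max_F |u|_∞`). -/
theorem sum_radial_le4 (h : ℕ → ℝ) (hh : ∀ r, 0 ≤ h r) (F : Finset (ZSite 4)) :
    ∑ u ∈ F, h (supNorm u) ≤ h 0 + ∑ r ∈ Finset.Ico 1 (F.sup supNorm + 1), 80 * (r : ℝ) ^ 3 * h r := by
  classical
  set M := F.sup supNorm with hM
  set B : Finset (ZSite 4) := Fintype.piFinset (fun _ : Fin 4 => Finset.Icc (-(M : ℤ)) M) with hB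
  have hFB : F ⊆ B := by
    intro u hu
    rw [hB, mem_box_iff]
    exact Finset.le_sup (f := supNorm) hu
  have hmaps : ∀ u ∈ B, supNorm u ∈ Finset.range (M + 1) := by
    intro u hu
    rw [hB, mem_box_iff] at hu
    rw [Finset.mem_range]
    omega
  have h1 : ∑ u ∈ F, h (supNorm u) ≤ ∑ u ∈ B, h (supNorm u) :=
    Finset.sum_le_sum_of_subset_of_nonneg hFB fun u _ _ => hh _
  have h2 : ∑ u ∈ B, h (supNorm u) = ∑ r ∈ Finset.range (M + 1), ((B.filter (fun u => supNorm u = r)).card : ℝ) * h r := by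
    rw [← Finset.sum_fiberwise_of_maps_to' hmaps]
    refine Finset.sum_congr rfl fun r _ => ?_
    rw [Finset.sum_const, nsmul_eq_mul]
  have h3 : ∑ r ∈ Finset.range (M + 1), ((B.filter (fun u => supNorm u = r)).card : ℝ) * h r =
      ((B.filter (fun u => supNorm u = 0)).card : ℝ) * h 0 +
        ∑ r ∈ Finset.Ico 1 (M + 1), ((B.filter (fun u => supNorm u = r)).card : ℝ) * h r := by
    rw [Finset.range_eq_Ico, ← Finset.sum_Ico_consecutive _ (Nat.zero_le 1) (by omega : 1 ≤ M + 1)]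
    simp
  have h4 : ((B.filter (fun u => supNorm u = 0)).card : ℝ) ≤ 1 := by
    have hsub : B.filter (fun u => supNorm u = 0) ⊆ {0} := by
      intro u hu
      rw [Finset.mem_filter] at hu
      rw [Finset.mem_singleton]
      exact (supNorm_eq_zero_iff u).1 hu.2
    have := Finset.card_le_card hsub
    rw [Finset.card_singleton] at this
    exact_mod_cast this
  have h5 : ∑ r ∈ Finset.Ico 1 (M + 1), ((B.filter (fun u => supNorm u = r)).card : ℝ) * h r ≤
      ∑ r ∈ Finset.Ico 1 (M + 1), 80 * (r : ℝ) ^ 3 * h r := by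
    refine Finset.sum_le_sum fun r hr => ?_
    rw [Finset.mem_Ico] at hr
    exact mul_le_mul_of_nonneg_right (card_shell_le4 M r hr.1) (hh r)
  calc ∑ u ∈ F, h (supNorm u) ≤ ∑ u ∈ B, h (supNorm u) := h1
    _ = _ := h2
    _ = _ := h3
    _ ≤ 1 * h 0 + ∑ r ∈ Finset.Ico 1 (M + 1), 80 * (r : ℝ) ^ 3 * h r := add_le_add (mul_le_mul_of_nonneg_right h4 (hh 0)) h5
    _ = _ := by rw [one_mul]

/-- [folklore] **THE LATTICE PROFILE SUMS ON `ℤ⁴`**: for `c > 0` and `p ∈ {2, 3}`, over any finite `F ⊂ ℤ⁴`,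
`Σ_{u∈F} (max 1 |u|_∞)^{−p}·e^{−c|u|_∞} ≤ 1 + 2560∕c^{4−p}` (shells `80r³`, then `Σ_{r≥1} r^{3−p}e^{−cr} ≤ 32∕c^{4−p}`). -/
theorem sum_profile4_le {c : ℝ} (hc : 0 < c) {p : ℕ} (hp2 : 2 ≤ p) (hp3 : p ≤ 3) (F : Finset (ZSite 4)) :
    ∑ u ∈ F, ((max 1 ((supNorm u : ℕ) : ℝ)) ^ p)⁻¹ * Real.exp (-(c * ((supNorm u : ℕ) : ℝ))) ≤ 1 + 2560 / c ^ (4 - p) := by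
  set h : ℕ → ℝ := fun r => ((max 1 (r : ℝ)) ^ p)⁻¹ * Real.exp (-(c * (r : ℝ))) with hh
  have hh0 : ∀ r, 0 ≤ h r := fun r => by positivity
  have hz : h 0 = 1 := by simp [hh]
  have hshell : ∀ r : ℕ, 1 ≤ r → 80 * (r : ℝ) ^ 3 * h r = 80 * ((r : ℝ) ^ (3 - p) * Real.exp (-(c * r))) := by
    intro r hr
    have hr1 : (1 : ℝ) ≤ r := by exact_mod_cast hr
    simp only [hh, max_eq_right hr1]
    have hrp : (r : ℝ) ^ 3 = (r : ℝ) ^ (3 - p) * (r : ℝ) ^ p := by rw [← pow_add]; congr 1; omega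
    have hr0 : (r : ℝ) ^ p ≠ 0 := pow_ne_zero _ (by linarith)
    rw [hrp]
    field_simp
  have hS : ∑ r ∈ Finset.Ico 1 (F.sup supNorm + 1), 80 * (r : ℝ) ^ 3 * h r ≤ 2560 / c ^ (4 - p) := by
    rw [Finset.sum_congr rfl fun r hr => hshell r (Finset.mem_Ico.1 hr).1, ← Finset.mul_sum]
    have h1 := sum_Ico_pow_mul_exp_le hc (m := 3 - p) (by omega) (F.sup supNorm + 1)
    rw [show 3 - p + 1 = 4 - p by omega] at h1
    calc 80 * ∑ r ∈ Finset.Ico 1 (F.sup supNorm + 1), (r : ℝ) ^ (3 - p) * Real.exp (-(c * r))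
        ≤ 80 * (32 / c ^ (4 - p)) := mul_le_mul_of_nonneg_left h1 (by norm_num)
      _ = 2560 / c ^ (4 - p) := by ring
  calc ∑ u ∈ F, ((max 1 ((supNorm u : ℕ) : ℝ)) ^ p)⁻¹ * Real.exp (-(c * ((supNorm u : ℕ) : ℝ))) = ∑ u ∈ F, h (supNorm u) := rfl
    _ ≤ h 0 + ∑ r ∈ Finset.Ico 1 (F.sup supNorm + 1), 80 * (r : ℝ) ^ 3 * h r := sum_radial_le4 h hh0 F
    _ ≤ 1 + 2560 / c ^ (4 - p) := by rw [hz]; exact add_le_add le_rfl hS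

end ShellsOpen


end Summit.QuantumFields.BalabanUV.Beta.D1BFx.GhostLegLattice

end
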